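import Summits.Ventures.Crystal3D.Theorems.StickyWulffConstantGenericWallFloorRayTerraceCapstone
import Summits.Ventures.Crystal3D.Theorems.StickyWulffConstantGenericWallFloorRayTerraceFarThree
import HarnessLib

/-!
# The terrace-steered steep family, part 8: the CAPSTONE on the `Σ27`-type caps through the terrace — census-free charge
# `(√2/2)·(A u)₂`, both grains (crux `GenericWallFloor`, stmt-Ventures-19480, line `WallLedgerG`; item (G-a) of DECISION (xlii))

HONEST FRAMING. Venture `Summits/Ventures/Crystal3D` (cell `crystal3d-full`), helper `--supports` the crux `GenericWallFloor`
(stmt-Ventures-19480) of `route-Ventures-StickyWulffConstant`, REGISTERED line `WallLedgerG`, open stub `stub_twoSlabAdhesion`.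
Rung credit only; F-C1 not moved; NOT the stub, NOT `c₀ = 1`: a ONE-SIDED floor `(√2/2)·(A u)₂` on the caps, modulo the named
facts `ExactOnly`(C12-55) and `StarPairFar` exactly as in `…RayTerraceCapstone` / 19480-p2's `…AtDirs`.  Census-free, standard axioms.

`…RayTerraceCapstone` fires 19480-p2's W1-conditional one-sided ledgers on the `Σ9` cap (far grain = two-letter word through the
terrace).  The same four family-side hypotheses hold VERBATIM when the far grain is presented by a THREE-letter reduced model word
through the terrace (the `Σ27`-type relations `Σ27a/Σ27b` reached through the terrace; the cap centre `w₀` = cubic `(1,1,4)/(3√2)` and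
the steering depend only on the first letter): `hsteep`, `hup`, `hdirs` are unchanged and `hmiss` is `image_ne_of_terrace_word_three`
(…RayTerraceFarThree) — valid for every three-letter word except the family's own level-2 ARRIVAL word
`[±(−1,−1,1), ±(1,−1,−1), ±(1,1,1)]/√3`.
* **`genericWallFloorAtCharge_terrace_up_three`** — grain 1 walking up: `GenericWallFloorAtCharge (√2·(A₁ u)₂/2) A₁ t₁ A₂ t₂` for
  `A₂·Λ₀ = (wordFrame A₁ [κ₀, κ₁, κ₂])·Λ₀`, `κ₂ = ±(1,1,1)/√3`, `¬(κ₁ = ±(1,−1,−1)/√3 ∧ κ₀ = ±(−1,−1,1)/√3)`, `‖A₁.symm e₃ − w₀‖ ≤ 1/4`.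
* **`genericWallFloorAtCharge_terrace_down_three`** — grain 2 walking down, mirror statement.
WHAT THIS IS NOT: `c₀ = 1` on these caps (shell rows / enumeration §51 + `DockedMenu`); the arrival word; F-C1 not moved.
-/

noncomputable section

namespace Summit.Ventures.Crystal3D.Theorems

open Summit.Ventures.Crystal3D Finset Matrix
open Literature.MathematicalPhysics.StatisticalMechanics (fccStacking)
open scoped InnerProductSpace

/-- **Census-free one-sided floor on the `Σ27`-type caps through the terrace, grain 1 walking UP.**  See the module docstring. -/
theorem genericWallFloorAtCharge_terrace_up_three
    {s₀ : EuclideanSpace ℝ (Fin 3)} (hs₀ : s₀ ∈ fccSlots)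
    (hcert : ExactOnly 0 (fccSlots.filter fun w => 0 < ⟪w, s₀⟫_ℝ)) (hSP : StarPairFar)
    (A₁ : EuclideanSpace ℝ (Fin 3) ≃ₗᵢ[ℝ] EuclideanSpace ℝ (Fin 3)) (t₁ : EuclideanSpace ℝ (Fin 3))
    (A₂ : EuclideanSpace ℝ (Fin 3) ≃ₗᵢ[ℝ] EuclideanSpace ℝ (Fin 3)) (t₂ : EuclideanSpace ℝ (Fin 3))
    {zs w₀ : EuclideanSpace ℝ (Fin 3)} (hzs1 : ‖zs‖ = 1)
    (hzsc : cubicCoords zs = (Real.sqrt 3269)⁻¹ • (![(34 : ℝ), 32, 33] : Fin 3 → ℝ))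
    (hw₀ : cubicCoords w₀ = (3 * Real.sqrt 2)⁻¹ • (![(1 : ℝ), 1, 4] : Fin 3 → ℝ))
    (hnear : ‖A₁.symm (EuclideanSpace.single (2 : Fin 3) (1 : ℝ)) - w₀‖ ≤ 1 / 4)
    (κ₀ κ₁ κ₂ : EuclideanSpace ℝ (Fin 3))
    (hκl : ∀ μ ∈ [κ₀, κ₁, κ₂], ‖μ‖ = 1 ∧
      ∀ w ∈ fccSlots, ⟪w, μ⟫_ℝ = 0 ∨ ⟪w, μ⟫_ℝ = Real.sqrt (2 / 3) ∨ ⟪w, μ⟫_ℝ = -Real.sqrt (2 / 3))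
    (hκc : List.IsChain (fun μ μ' => ⟪μ, μ'⟫_ℝ = 1 / 3 ∨ ⟪μ, μ'⟫_ℝ = -1 / 3) [κ₀, κ₁, κ₂])
    (hκ₂ : cubicCoords κ₂ = (Real.sqrt 3)⁻¹ • (![(1 : ℝ), 1, 1] : Fin 3 → ℝ) ∨
      cubicCoords κ₂ = -((Real.sqrt 3)⁻¹ • (![(1 : ℝ), 1, 1] : Fin 3 → ℝ)))
    (hκ₀₁ : ¬ ((cubicCoords κ₁ = (Real.sqrt 3)⁻¹ • (![(1 : ℝ), -1, -1] : Fin 3 → ℝ) ∨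
        cubicCoords κ₁ = -((Real.sqrt 3)⁻¹ • (![(1 : ℝ), -1, -1] : Fin 3 → ℝ))) ∧
      (cubicCoords κ₀ = (Real.sqrt 3)⁻¹ • (![(-1 : ℝ), -1, 1] : Fin 3 → ℝ) ∨
        cubicCoords κ₀ = -((Real.sqrt 3)⁻¹ • (![(-1 : ℝ), -1, 1] : Fin 3 → ℝ)))))
    (hB : A₂ '' fccStacking 1 (Real.sqrt (2 / 3)) = (wordFrame A₁ [κ₀, κ₁, κ₂]) '' fccStacking 1 (Real.sqrt (2 / 3))) :
    GenericWallFloorAtCharge (Real.sqrt 2 * (A₁ (slotSite 8)) 2 / 2) A₁ t₁ A₂ t₂ := by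
  obtain ⟨zs', hzs1', hzsc', ht, hA⟩ := exists_terrace_steering
  have hzz : zs = zs' := cubicCoords_injective (by rw [hzsc, hzsc'])
  subst hzz
  obtain ⟨hZ, hsteep⟩ := hA A₁
  have hz : ‖A₁ zs‖ = 1 := by rw [LinearIsometryEquiv.norm_map, hzs1]
  have he₃ : (A₁ (slotSite 8)) 2 = ⟪A₁ (slotSite 8), EuclideanSpace.single (2 : Fin 3) (1 : ℝ)⟫_ℝ := by
    rw [EuclideanSpace.inner_single_right]; simp
  have hup : (1 / 4 : ℝ) ≤ (A₁ (slotSite 8)) 2 := by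
    rw [he₃]; have := start_slot_inner_ge A₁ hw₀ (EuclideanSpace.single (2 : Fin 3) (1 : ℝ)); linarith
  exact genericWallFloorAtCharge_oneSided_dirs hs₀ hcert hSP A₁ t₁ A₂ t₂ hz (slotSite_mem 8) hsteep (by norm_num) hup
    (image_ne_of_terrace_word_three A₁ A₂ hZ ht κ₀ κ₁ κ₂ hκl hκc hκ₂ hκ₀₁ hB)
    (hdirs_terrace_up A₁ hZ ht hw₀ (by linarith))

/-- **Census-free one-sided floor on the `Σ27`-type caps through the terrace, grain 2 walking DOWN** (mirror statement: inward
vertical `−e₃`, the far grain `A₁` presented over `A₂` by the three-letter word through `A₂`'s terrace). -/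
theorem genericWallFloorAtCharge_terrace_down_three
    {s₀ : EuclideanSpace ℝ (Fin 3)} (hs₀ : s₀ ∈ fccSlots)
    (hcert : ExactOnly 0 (fccSlots.filter fun w => 0 < ⟪w, s₀⟫_ℝ)) (hSP : StarPairFar)
    (A₁ : EuclideanSpace ℝ (Fin 3) ≃ₗᵢ[ℝ] EuclideanSpace ℝ (Fin 3)) (t₁ : EuclideanSpace ℝ (Fin 3))
    (A₂ : EuclideanSpace ℝ (Fin 3) ≃ₗᵢ[ℝ] EuclideanSpace ℝ (Fin 3)) (t₂ : EuclideanSpace ℝ (Fin 3))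
    {zs w₀ : EuclideanSpace ℝ (Fin 3)} (hzs1 : ‖zs‖ = 1)
    (hzsc : cubicCoords zs = (Real.sqrt 3269)⁻¹ • (![(34 : ℝ), 32, 33] : Fin 3 → ℝ))
    (hw₀ : cubicCoords w₀ = (3 * Real.sqrt 2)⁻¹ • (![(1 : ℝ), 1, 4] : Fin 3 → ℝ))
    (hnear : ‖A₂.symm (-EuclideanSpace.single (2 : Fin 3) (1 : ℝ)) - w₀‖ ≤ 1 / 4)
    (κ₀ κ₁ κ₂ : EuclideanSpace ℝ (Fin 3))
    (hκl : ∀ μ ∈ [κ₀, κ₁, κ₂], ‖μ‖ = 1 ∧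
      ∀ w ∈ fccSlots, ⟪w, μ⟫_ℝ = 0 ∨ ⟪w, μ⟫_ℝ = Real.sqrt (2 / 3) ∨ ⟪w, μ⟫_ℝ = -Real.sqrt (2 / 3))
    (hκc : List.IsChain (fun μ μ' => ⟪μ, μ'⟫_ℝ = 1 / 3 ∨ ⟪μ, μ'⟫_ℝ = -1 / 3) [κ₀, κ₁, κ₂])
    (hκ₂ : cubicCoords κ₂ = (Real.sqrt 3)⁻¹ • (![(1 : ℝ), 1, 1] : Fin 3 → ℝ) ∨
      cubicCoords κ₂ = -((Real.sqrt 3)⁻¹ • (![(1 : ℝ), 1, 1] : Fin 3 → ℝ)))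
    (hκ₀₁ : ¬ ((cubicCoords κ₁ = (Real.sqrt 3)⁻¹ • (![(1 : ℝ), -1, -1] : Fin 3 → ℝ) ∨
        cubicCoords κ₁ = -((Real.sqrt 3)⁻¹ • (![(1 : ℝ), -1, -1] : Fin 3 → ℝ))) ∧
      (cubicCoords κ₀ = (Real.sqrt 3)⁻¹ • (![(-1 : ℝ), -1, 1] : Fin 3 → ℝ) ∨
        cubicCoords κ₀ = -((Real.sqrt 3)⁻¹ • (![(-1 : ℝ), -1, 1] : Fin 3 → ℝ)))))
    (hB : A₁ '' fccStacking 1 (Real.sqrt (2 / 3)) = (wordFrame A₂ [κ₀, κ₁, κ₂]) '' fccStacking 1 (Real.sqrt (2 / 3))) :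
    GenericWallFloorAtCharge (Real.sqrt 2 * (-(A₂ (slotSite 8)) 2) / 2) A₁ t₁ A₂ t₂ := by
  obtain ⟨zs', hzs1', hzsc', ht, hA⟩ := exists_terrace_steering
  have hzz : zs = zs' := cubicCoords_injective (by rw [hzsc, hzsc'])
  subst hzz
  obtain ⟨hZ, hsteep⟩ := hA A₂
  have hz : ‖A₂ zs‖ = 1 := by rw [LinearIsometryEquiv.norm_map, hzs1]
  have he₃ : -(A₂ (slotSite 8)) 2 = ⟪A₂ (slotSite 8), -EuclideanSpace.single (2 : Fin 3) (1 : ℝ)⟫_ℝ := by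
    rw [inner_neg_right, EuclideanSpace.inner_single_right]; simp
  have hdown : (1 / 4 : ℝ) ≤ -(A₂ (slotSite 8)) 2 := by
    rw [he₃]; have := start_slot_inner_ge A₂ hw₀ (-EuclideanSpace.single (2 : Fin 3) (1 : ℝ)); linarith
  exact genericWallFloorAtCharge_oneSidedDown_dirs hs₀ hcert hSP A₁ t₁ A₂ t₂ hz (slotSite_mem 8) hsteep (by norm_num) hdown
    (image_ne_of_terrace_word_three A₂ A₁ hZ ht κ₀ κ₁ κ₂ hκl hκc hκ₂ hκ₀₁ hB)
    (hdirs_terrace_down A₂ hZ ht hw₀ (by linarith))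

end Summit.Ventures.Crystal3D.Theorems

end
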